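import Summits.FinalStateConjecture.FinalStateConjecture.Theorems.SwallowTheDatumUniversalWitnessFamilyRegionOneAssembly
import Summits.FinalStateConjecture.FinalStateConjecture.Theorems.HonestFixedRadiusSettling.Negative.KillShape
import Summits.FinalStateConjecture.FinalStateConjecture.Theorems.StarvedNecksHonestFixedRadiusSettlingStubRegionOneHoleClauses
import Summits.FinalStateConjecture.FinalStateConjecture.Theorems.StarvedNecksHonestFixedRadiusSettlingStubRegionOneFlatClauses
import Summits.FinalStateConjecture.FinalStateConjecture.Theorems.StarvedNecksHonestFixedRadiusSettlingStubRegionOneFarCloseness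
import Summits.FinalStateConjecture.FinalStateConjecture.Theorems.StarvedNecksHonestFixedRadiusSettlingStubFarSlabNoEscape
import HarnessLib

/-!
# Crux `StarvedNecks.HonestFixedRadiusSettling` (stmt-FinalStateConjecture-13550), line `far-field-surgery`
# (sheet burial, lead c2): REGION I CARRIES AN HONEST `C⁴` DECOMPOSITION

The Schwarzschild exterior `Kerr.spacetime M 0 (2M)` (Kruskal region I over the time-symmetric sheet
`Σ₀ = range ψ`) carries the `N = 1` final-state decomposition of the landed
`SwallowTheDatum.UniversalWitnessFamily.stub_regionOneDecomposition` (hole chart `holeMap M T₀`, flat chart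
`outMap M` on `{x⁰ > T₀ + 1, ‖x̃‖ > excision M x⁰}`), read here at `k = 4` (its deviation lemmas are
order-free), and this decomposition is HONEST in the sense of the crux: it lies in
`Negative.honestCoreSet ∩ Negative.honestFarSet` at `R₀ = 100M` (the landed stubs `stub_regionOneHoleClauses`
— anchoring by the static Killing flow and closed late tube portions —, `stub_regionOneFlatClauses` —
future-oriented flat chart, flat-late points below later flat slabs, closed far flat slabs — and
`stub_regionOneFarCloseness` — `C⁰` closeness `1/10` of the bent hole chart beyond `100M`), with
`O = J⁺(Σ₀) ∩ I⁻(charted)`; moreover its far flat slabs do NOT ESCAPE along any isometric time-oriented open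
embedding of region I into a Cauchy development over the sheet, granted properness of the sheet chart and no
future accumulation (the landed dichotomy `stub_farSlabNoEscape`).  This is the region-I half of the sheet-burial
composition of the crux (`…SheetBurialLine.lean`).
-/

set_option linter.dupNamespace false

noncomputable section

namespace Summit.FinalStateConjecture.FinalStateConjecture.Theorems.StarvedNecks.SheetBurial

open scoped Manifold ContDiff Topology
open Set Filter Function Literature.Geometry.Lorentzian
open Summit.FinalStateConjecture.FinalStateConjecture.Theorems.HonestFixedRadiusSettling.Negative
  (honestCoreSet honestFarSet)
open Summit.FinalStateConjecture.FinalStateConjecture.Theorems.SwallowTheDatum.UniversalWitnessFamily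

/-- The identity of the Lorentz group, as a map, is the identity. -/
theorem lorentzGroup_one_apply (v : E4) : ((1 : lorentzGroup) : E4 ≃L[ℝ] E4) v = v := rfl

/-- The identity of the Lorentz group, as a continuous linear map, has operator norm `1`. -/
theorem norm_lorentzGroup_one : ‖(((1 : lorentzGroup) : E4 ≃L[ℝ] E4) : E4 →L[ℝ] E4)‖ = 1 := by
  have : (((1 : lorentzGroup) : E4 ≃L[ℝ] E4) : E4 →L[ℝ] E4) = ContinuousLinearMap.id ℝ E4 := rfl
  rw [this]
  exact ContinuousLinearMap.norm_id

/-- **Region I carries an HONEST `C⁴` `N = 1` decomposition, with the no-escape certificate of its far flat slabs.**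
In `Kerr.spacetime M 0 (2M)` with the static slice `Σ₀ = range ψ`: the region `O = J⁺(Σ₀) ∩ I⁻(charted)` carries the
decomposition of the landed `stub_regionOneDecomposition` read at `k = 4` (hole chart `holeMap M T₀`, flat chart
`outMap M` on `{x⁰ > T₀ + 1, ‖x̃‖ > excision M x⁰}`), which lies in `honestCoreSet ∩ honestFarSet` at `R₀ = 100M`
(`stub_regionOneHoleClauses`, `stub_regionOneFlatClauses`, `stub_regionOneFarCloseness`), and whose far flat slabs do not escape along any isometric time-oriented open embedding of region I
into a Cauchy development over the sheet, granted properness of the sheet chart and no future accumulation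
(`stub_farSlabNoEscape`). [cite: DafermosLuk2017, Conjecture 1 (b)–(c)] [cite: ONeill1983, Ch. 13] -/
theorem regionOneHonestDecomposition : ∀ [Kerr.Facts] {M : ℝ} (hM : 0 < M) (ψ : Schwarzschild.isotropicExterior M → Kerr.region 0 (Kerr.rPlus M 0)) (hψ : ∀ y, (ψ y : E4) = E4.ofTimeSpace (2 * M * Real.log (‖(y : E3)‖ * (1 + M / (2 * ‖(y : E3)‖)) ^ 2 / (2 * M) - 1)) ((1 + M / (2 * ‖(y : E3)‖)) ^ 2 • (y : E3))), ∃ (O : Set (Kerr.region 0 (Kerr.rPlus M 0))) (dec : FinalStateDecomposition (Kerr.spacetime M 0 (Kerr.rPlus M 0) hM.le) O 4) (R₀ : ℝ), O = (Kerr.smoothMetric M 0 (Kerr.rPlus M 0)).causalFuture (ksTime hM.le) (Set.range ψ) ∩ (Kerr.smoothMetric M 0 (Kerr.rPlus M 0)).chronologicalPast (ksTime hM.le) dec.charted ∧ dec ∈ honestCoreSet (Kerr.spacetime M 0 (Kerr.rPlus M 0) hM.le) O 4 R₀ ∧ dec ∈ honestFarSet (Kerr.spacetime M 0 (Kerr.rPlus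 M 0) hM.le) O 4 R₀ ∧ ∀ (X : Type) [TopologicalSpace X] [ChartedSpace E3 X] [IsManifold (𝓡 3) ∞ X] [T2Space X] [SecondCountableTopology X] [ConnectedSpace X] (D : InitialDataSet (𝓡 3) X) (𝒟 : CauchyDevelopment D) (Φ' : Schwarzschild.isotropicExterior M → X) (χ : (Kerr.spacetime M 0 (Kerr.rPlus M 0) hM.le).carrier → 𝒟.carrier), ContMDiff (𝓡 4) (𝓡 4) ∞ χ → Topology.IsOpenEmbedding χ → (Kerr.spacetime M 0 (Kerr.rPlus M 0) hM.le).metric.IsIsometricImmersion 𝒟.metric.toPseudoRiemannianMetric χ → (Kerr.spacetime M 0 (Kerr.rPlus M 0) hM.le).timeOrientation.PreservesTimeOrientation χ 𝒟.timeOrientation → χ ∘ ψ = 𝒟.embed ∘ Φ' → (∀ K : Set X, IsCompact K → ∃ R' : ℝ, ∀ y : Schwarzschild.isotropicExterior M, R' < ‖(y : E3)‖ → Φ' y ∉ K) → (∀ (p : ℕ → Kerr.region 0 (Kerr.rPlus M 0)) (r₁ r₂ : ℝ), 2 * M < r₁ → (∀ n, r₁ ≤ E4.spatialNorm (p n).1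 ∧ E4.spatialNorm (p n).1 ≤ r₂) → Tendsto (fun n ↦ staticTime M (p n).1) atTop atTop → ∀ z : 𝒟.carrier, ¬ Tendsto (fun n ↦ χ (p n)) atTop (𝓝 z)) → ∀ τ' : ℝ, dec.τ₀ < τ' → closure (χ '' (dec.flatChart '' {y | τ' ≤ y.1 0 ∧ ∀ i, dec.excision i (y.1 0) + 1 ≤ (dec.background i).radius y.1})) ⊆ Set.range χ := by
  intro _ M hM ψ hψ
  obtain ⟨T₀, -, hT0, hmono, htor⟩ := exists_lateTime hM
  obtain ⟨Θ, -, hΘs⟩ := exists_timeReflection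
  -- the region `O = {t ≥ 0}`
  obtain ⟨O, hO⟩ : ∃ O : Set (Kerr.region 0 (Kerr.rPlus M 0)), O = {p | 0 ≤ staticTime M p.1} := ⟨_, rfl⟩
  have hJO : (Kerr.smoothMetric M 0 (Kerr.rPlus M 0)).causalFuture (ksTime hM.le) (Set.range ψ) = O := by
    rw [hO]; exact causalFuture_range_sheet hM hψ
  -- the hole chart
  let Bh : ModelBackground := boostedKerrBackground 1 0 M 0
  let chart : Bh.domain → Kerr.region 0 (Kerr.rPlus M 0) :=
    fun y ↦ ⟨holeMap M T₀ y.1, holeMap_mem_region hM T₀ ((mem_holeDomain hM.le).1 y.2)⟩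
  have hchart : ∀ y, (chart y : E4) = holeMap M T₀ y := fun _ ↦ rfl
  have hchart_late : chart '' Bh.lateRegion (T₀ + 1) ⊆ O := by
    rintro _ ⟨y, hy, rfl⟩
    have hy0 : T₀ + 1 < y.1 0 := mem_holeLateRegion.1 hy
    have hyr : 2 * M < E4.spatialNorm y.1 := (mem_holeDomain hM.le).1 y.2
    rw [hO]
    show 0 ≤ staticTime M (holeMap M T₀ y.1)
    rw [holeMap_of_le M hy0.le, staticTime_bentMap]
    exact staticTime_bent_nonneg hM htor hT0.le (by linarith) hyr
  -- the flat chart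
  let Ωf : TopologicalSpace.Opens E4 :=
    ⟨{x | 2 * M < E4.spatialNorm x}, isOpen_lt continuous_const (continuous_norm.comp E4.spatial.continuous)⟩
  have hΩf : ∀ x ∈ Ωf, 2 * M < E4.spatialNorm x := fun _ h ↦ h
  let Bf : ModelBackground := ⟨Ωf, fun x ↦ boostedKerrBilin Θ 0 M 0 x, fun x ↦ x 0, E4.spatialNorm⟩
  let Φf : Bf.domain → Kerr.region 0 (Kerr.rPlus M 0) :=
    fun y ↦ ⟨outMap M y.1, outMap_mem_region hM (hΩf y.1 y.2)⟩
  have hΦf : ∀ y, (Φf y : E4) = outMap M y := fun _ ↦ rfl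
  have hc0 : Continuous fun y : E4 ↦ y 0 := PiLp.continuous_apply 2 _ 0
  let U'' : TopologicalSpace.Opens E4 := ⟨{x | T₀ + 1 < x 0 ∧ excision M (x 0) < E4.spatialNorm x},
    (isOpen_lt continuous_const hc0).inter
      (isOpen_lt ((continuous_excision M).comp hc0) (continuous_norm.comp E4.spatial.continuous))⟩
  have hU'' : ∀ x, x ∈ U'' ↔ T₀ + 1 < x 0 ∧ excision M (x 0) < E4.spatialNorm x := fun _ ↦ Iff.rfl
  have hU''4 : ∀ x ∈ U'', 4 * M < E4.spatialNorm x := fun x hx ↦ (four_mul_lt_excision hM (x 0)).trans hx.2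
  have hle : (Minkowski.backgroundOn U'').domain ≤ Bf.domain := fun x hx ↦
    show 2 * M < E4.spatialNorm x by linarith [hU''4 x hx]
  let flat : (Minkowski.backgroundOn U'').domain → Kerr.region 0 (Kerr.rPlus M 0) :=
    Φf ∘ TopologicalSpace.Opens.inclusion hle
  have hflat : ∀ y, (flat y : E4) = outMap M y := fun _ ↦ rfl
  have hflatΩ : ∀ x ∈ U'', 2 * M < E4.spatialNorm x := fun x hx ↦ hle hx
  have hflat_late : ∀ τ₁, T₀ + 1 ≤ τ₁ → flat '' (Minkowski.backgroundOn U'').lateRegion τ₁ ⊆ O := by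
    rintro τ₁ hτ₁ _ ⟨y, hy, rfl⟩
    have hy1 : τ₁ < y.1 0 := hy
    rw [hO]
    show 0 ≤ staticTime M (outMap M y.1)
    have := le_staticTime_outMap hM (hU''4 y.1 y.2).le
    linarith
  -- vertical flows: `I⁻(hole late image) = everything`
  have hflowI : ∀ p : Kerr.region 0 (Kerr.rPlus M 0),
      p ∈ (Kerr.smoothMetric M 0 (Kerr.rPlus M 0)).chronologicalPast (ksTime hM.le)
        (chart '' Bh.lateRegion (T₀ + 1)) := by
    intro p
    set f : ℝ := (T₀ + 1) + bend M (T₀ + 1) (E4.spatialNorm p.1) with hf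
    set s : ℝ := max 1 (f - p.1 0 + 1) with hs
    have hs0 : 0 < s := lt_of_lt_of_le one_pos (le_max_left _ _)
    have hq : vert p s ∈ chart '' Bh.lateRegion (T₀ + 1) := by
      rw [image_holeChart_lateRegion chart hchart hM hmono]
      show (T₀ + 1) + bend M (T₀ + 1) (E4.spatialNorm (vert p s).1) < (vert p s).1 0
      rw [spatialNorm_vert, vert_apply_zero, ← hf]
      have := le_max_right 1 (f - p.1 0 + 1)
      linarith
    exact LorentzianMetric.chronologicalFuture_mono (singleton_subset_iff.2 hq) (mem_chronologicalPast_vert hM p hs0)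
  -- the decomposition (verbatim the landed one, read at `k = 4`)
  let d : FinalStateDecomposition (Kerr.spacetime M 0 (Kerr.rPlus M 0) hM.le) O 4 :=
    { N := 1
      mass := fun _ ↦ M
      spin := fun _ ↦ 0
      mass_pos := fun _ ↦ hM
      abs_spin_le_mass := fun _ ↦ by rw [abs_zero]; exact hM.le
      motion := fun _ ↦ (1, 0)
      τ₀ := T₀ + 1
      chart := fun _ ↦ chart
      isLateChart := fun _ ↦ ⟨contMDiff_holeChart chart hchart hM,
        isOpenEmbedding_restrict_holeChart chart hchart hM hmono, hchart_late⟩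
      tendsto_truncDeviationCk := fun _ R ↦ tendsto_truncDeviationCk_holeChart chart hchart hM 4
        ((tendsto_exactRadius_atTop hM).eventually_gt_atTop R)
      exists_pairwise_disjoint := fun _ ↦ ⟨0, Subsingleton.pairwise⟩
      excision := fun _ ↦ excision M
      tendsto_excision_div := fun _ ↦ tendsto_excision_div_atTop hM
      flatDomain := U''
      setOf_lt_excision_subset_flatDomain := fun x hx ↦ ⟨hx.1, by
        have := hx.2 0
        rwa [poincareInv_one_zero, Kerr.radius_zero_left] at this⟩
      flatChart := flat
      isLateChart_flat := ⟨(contMDiff_outChart hM hΩf Φf hΦf).comp (contMDiff_inclusion hle),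
        isOpenEmbedding_restrict_outChart hM hflatΩ flat hflat
          (isOpen_lt continuous_const (hc0.comp continuous_subtype_val)),
        hflat_late (T₀ + 1) le_rfl⟩
      tendsto_deviationCk_flat := tendsto_deviationCk_outChart hM hΘs Bf rfl (fun _ ↦ rfl) (fun _ ↦ rfl) hΩf
        Φf hΦf 4 (tendsto_excision_atTop hM) (W := U'') (fun z hz ↦ hz.2) hle
      diff_subset_causalPast := by
        intro p hp
        have hp2 : p ∉ chart '' Bh.lateRegion (T₀ + 1) := fun h ↦
          hp.2 (Or.inl (Set.mem_iUnion.mpr ⟨0, h⟩))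
        rw [image_holeChart_lateRegion chart hchart hM hmono] at hp2
        have hle' : p.1 0 ≤ (T₀ + 1) + bend M (T₀ + 1) (E4.spatialNorm p.1) := le_of_not_gt hp2
        have hq : vert p ((T₀ + 1) + bend M (T₀ + 1) (E4.spatialNorm p.1) - p.1 0) ∈
            chart '' Bh.timeSlab (T₀ + 1) := by
          rw [image_holeChart_timeSlab chart hchart hM le_rfl]
          show (vert p _).1 0 = (T₀ + 1) + bend M (T₀ + 1) (E4.spatialNorm (vert p _).1)
          rw [spatialNorm_vert, vert_apply_zero]; ring
        refine LorentzianMetric.causalFuture_mono ?_ (mem_causalPast_vert hM p (sub_nonneg.2 hle'))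
        exact singleton_subset_iff.2 (Or.inl (Set.mem_iUnion.mpr ⟨0, hq⟩)) }
  -- the radius of the (only) hole background, read on the flat coordinates, is `‖ỹ‖`
  have hfarset : ∀ τ' : ℝ, {y : d.flatDomain | τ' ≤ y.1 0 ∧
      ∀ i, d.excision i (y.1 0) + 1 ≤ (d.background i).radius y.1} =
      {y : (Minkowski.backgroundOn U'').domain | τ' ≤ y.1 0 ∧ excision M (y.1 0) + 1 ≤ E4.spatialNorm y.1} := by
    intro τ'
    ext y
    simp only [Set.mem_setOf_eq]
    constructor
    · rintro ⟨h1, h2⟩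
      refine ⟨h1, ?_⟩
      have := h2 0
      rwa [show (d.background 0).radius y.1 = E4.spatialNorm y.1 from holeBackground_radius M y.1] at this
    · rintro ⟨h1, h2⟩
      refine ⟨h1, fun i ↦ ?_⟩
      rwa [show (d.background i).radius y.1 = E4.spatialNorm y.1 from holeBackground_radius M y.1]
  -- the three packages of honest clauses
  obtain ⟨hC2, hC3⟩ := stub_regionOneHoleClauses M hM T₀ hmono chart hchart
  obtain ⟨hC4, hF1, hF2⟩ := stub_regionOneFlatClauses M hM T₀ hT0.le U'' hU'' flat hflat
  obtain ⟨T, hT⟩ := stub_regionOneFarCloseness M hM T₀ chart hchart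
  refine ⟨O, d, 100 * M, ?_, ?_, ?_, ?_⟩
  · -- `O = J⁺(Σ₀) ∩ I⁻(charted)`
    rw [hJO]
    refine Set.Subset.antisymm (fun p hp ↦ ⟨hp, ?_⟩) inter_subset_left
    refine LorentzianMetric.chronologicalFuture_mono ?_ (hflowI p)
    exact (Set.subset_iUnion (fun i : Fin 1 ↦ d.chart i '' (d.background i).lateRegion d.τ₀) 0).trans
      subset_union_right
  · -- HonestCore
    refine ⟨fun _ ↦ ⟨?_, le_rfl, ?_⟩, fun _ ϱ τ₂ _ hτ₂ ↦ hC2 ϱ τ₂ hτ₂,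
      fun _ τ' ϱ hϱ hτ' ↦ ?_, fun y hy ↦ hC4 y hy⟩
    · show |(0 : ℝ)| < M
      rw [abs_zero]; exact hM
    · show (0 : ℝ) < ((1 : lorentzGroup) : E4 ≃L[ℝ] E4) (E4.basisVector 0) 0
      rw [lorentzGroup_one_apply]
      simp [E4.basisVector]
    · intro A p hp
      exact hC3 τ' ϱ hϱ hτ' hp.1
  · -- HonestFar
    refine ⟨fun τ₂ hτ₂ ↦ hF1 τ₂ hτ₂, fun τ' hτ' ↦ ?_, fun _ ↦ ?_⟩
    · exact (closure_mono (Set.image_mono (hfarset τ').subset)).trans (hF2 τ' hτ')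
    · refine ⟨T, ?_⟩
      rw [norm_lorentzGroup_one, one_pow, mul_one]
      refine le_trans (supCkENorm_mono (Set.image_mono ?_) _ _) hT
      intro x hx
      exact ⟨hx.1, hx.2.1⟩
  · -- no escape of the far flat slabs
    intro X _ _ _ _ _ _ D 𝒟 Φ' χ hχ hχo hiso hτ hcomm hproper hnoacc τ' hτ'
    exact (closure_mono (Set.image_mono (Set.image_mono (hfarset τ').subset))).trans
      (stub_farSlabNoEscape M hM T₀ hT0.le U'' hU'' flat hflat X D 𝒟 Φ' ψ hψ χ hχ hχo hiso hτ hcomm hproper hnoacc τ' hτ')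

/-- The static slice maps into the Cauchy hypersurface: `χ({t = 0}) = χ(range ψ) = ι(Φ'(sheet)) ⊆ range ι`. -/
theorem image_staticSlice_subset [Kerr.Facts] {M : ℝ} (hM : 0 < M)
    {ψ : Schwarzschild.isotropicExterior M → Kerr.region 0 (Kerr.rPlus M 0)}
    (hψ : ∀ y, (ψ y : E4) =
      E4.ofTimeSpace (2 * M * Real.log (‖(y : E3)‖ * (1 + M / (2 * ‖(y : E3)‖)) ^ 2 / (2 * M) - 1))
        ((1 + M / (2 * ‖(y : E3)‖)) ^ 2 • (y : E3)))
    {X : Type} [TopologicalSpace X] [ChartedSpace E3 X] [IsManifold (𝓡 3) ∞ X] [ConnectedSpace X]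
    {D : InitialDataSet (𝓡 3) X} (𝒟 : CauchyDevelopment D) {Φ' : Schwarzschild.isotropicExterior M → X}
    {χ : (Kerr.spacetime M 0 (Kerr.rPlus M 0) hM.le).carrier → 𝒟.carrier} (hcomm : χ ∘ ψ = 𝒟.embed ∘ Φ') :
    χ '' {p : (Kerr.spacetime M 0 (Kerr.rPlus M 0) hM.le).carrier | staticTime M p.1 = 0} ⊆
      Set.range 𝒟.embed := by
  rintro _ ⟨p, hp, rfl⟩
  have hp' : (p : Kerr.region 0 (Kerr.rPlus M 0)) ∈ Set.range ψ := by
    rw [range_sheet_eq hM hψ]; exact hp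
  obtain ⟨y, hy⟩ := hp'
  exact ⟨Φ' y, by rw [← hy]; exact (congrFun hcomm y).symm⟩


end Summit.FinalStateConjecture.FinalStateConjecture.Theorems.StarvedNecks.SheetBurial

end
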